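import Summits.KontsevichZagierPeriods.KontsevichZagierPeriods.Theorems.RootDecompWalshStrataConeMoves

/-!
# The cone specimen, part 3/3: the cone lands in the Baker sector

`[quarter disc, w] ≡ [(0,1), w·√(1−u²)]` (rule (3), fibres `[0, √(1−u²)]`), Euler's substitution
`x = (1−t²)/(1+t²)` as a rule-(2) diffeomorphism of `(0,1)` (`[(0,1), w·8t²/(1+t²)³] ≡ [(0,1), w·√(1−x²)]`), and
the conclusion `cone_bakerDescent`: every representation with the cone's domain and integrand `1` is congruent
modulo `KZ.relations` to `[(0,1), 8t²/(3(1+t²)³)]`, a RATIONAL one-variable representation — the instance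
`(d, P, q) = (3, z²−x²−y², 1)` of `QuadricBakerDescent` (lens file WalshStrata.lean v3), i.e.
`π/12 = ∫₀¹ 8t²/(3(1+t²)³) dt` as a chain of six KZ moves. Imports: part 2 of the specimen (hence Literature + the landed Walsh-cell module); 0 sorry.
[KontsevichZagier2001 §1.1–1.2]
-/

noncomputable section

open Literature.NumberTheory.Transcendental
open MeasureTheory Set
open MvPolynomial (aeval X C)
open Literature.ModelTheory.ExponentialFields (IsSemialgebraic isSemialgebraic_setOf_eval_pos
  isSemialgebraic_setOf_eval_lt continuous_aeval_real)
open Summit.KontsevichZagierPeriods.RootDecompWalshStrata.WalshSpanProof (isSemialgebraic_cubeSet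
  isBounded_cubeSet cellRep cellRep_domain cellRep_integrand)

namespace Summit.KontsevichZagierPeriods.RootDecompWalshStrata.ConeSpecimen

/-! #### `[Q, w] ≡ [(0,1), w·√(1−u²)]` -/

/-- The open unit interval inside `ℝ¹` (the Walsh 1-cell). -/
def unitIoo : Set (Fin 1 → ℝ) := {u | ∀ j, 0 < u j ∧ u j < 1}

/-- The open unit interval in `ℝ¹` is `ℚ`-semialgebraic. [BCR1998 §2.1] -/
theorem isSemialgebraic_unitIoo : IsSemialgebraic ℚ unitIoo := isSemialgebraic_cubeSet 1

/-- The open unit interval lies in the closed unit cube of `ℝ¹`. [folklore] -/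
theorem unitIoo_subset_Icc : unitIoo ⊆ Icc 0 1 := fun _ hu =>
  ⟨fun j => (hu j).1.le, fun j => (hu j).2.le⟩

/-- Membership in the open unit interval of `ℝ¹`. [definition] -/
theorem mem_unitIoo {u : Fin 1 → ℝ} : u ∈ unitIoo ↔ 0 < u 0 ∧ u 0 < 1 := by
  refine ⟨fun h => h 0, fun h j => ?_⟩
  fin_cases j
  exact h

/-- `Fin.snoc u t` at the literal indices `1, 0 : Fin 2` (one `simp` lemma; a local copy is kept because the
landed twins live in modules that are unbuilt on the farm or inside another route's cone). [folklore] -/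
@[simp] theorem snoc₁_apply (u : Fin 1 → ℝ) (t : ℝ) :
    (Fin.snoc u t : Fin 2 → ℝ) 1 = t ∧ (Fin.snoc u t : Fin 2 → ℝ) 0 = u 0 := ⟨rfl, rfl⟩

/-- `u ↦ √(1 − u²)` is `ℚ`-semialgebraic on `(0,1)`. [BCR1998 §2.2] -/
theorem isSemialgebraicFunOn_sqrtOneSub :
    IsSemialgebraicFunOn ℚ unitIoo (fun u : Fin 1 → ℝ => √(1 - u 0 ^ 2)) :=
  (IsSemialgebraicFunOn.sqrt_holds
    (isSemialgebraicFunOn_aeval isSemialgebraic_unitIoo (1 - X 0 ^ 2))).congr fun u _ => by simp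

/-- `[(0,1), w · √(1 − u²)]` (an ALGEBRAIC one-variable integrand). [KontsevichZagier2001 §1.1] -/
def sqrtRep (w : ℚ) : KZ.IntegralRep 1 where
  domain := unitIoo
  integrand u := (w : ℝ) * √(1 - u 0 ^ 2)
  isSemialgebraic_domain := isSemialgebraic_unitIoo
  isSemialgebraicFunOn_integrand :=
    IsSemialgebraicFunOn.mul_holds (isSemialgebraicFunOn_ratCast isSemialgebraic_unitIoo w)
      isSemialgebraicFunOn_sqrtOneSub
  integrableOn :=
    ((continuous_const.mul (Real.continuous_sqrt.comp
      (continuous_const.sub ((continuous_apply 0).pow 2)))).continuousOn.integrableOn_compact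
        isCompact_Icc).mono_set unitIoo_subset_Icc

/-- The open quarter disc is the open band `0 < v < √(1 − u²)` over `(0,1)`. [folklore] -/
theorem mem_disc_iff_init (z : Fin 2 → ℝ) :
    z ∈ {w : Fin 2 → ℝ | (∀ j, 0 < w j ∧ w j < 1) ∧ 0 < aeval w discPoly} ↔
      Fin.init z ∈ unitIoo ∧ 0 < z (Fin.last 1) ∧ z (Fin.last 1) < √(1 - Fin.init z 0 ^ 2) := by
  simp only [mem_setOf_eq, aeval_discPoly, mem_unitIoo, Fin.init]
  constructor
  · rintro ⟨hw, hg⟩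
    refine ⟨by simpa using hw 0, (hw 1).1, ?_⟩
    exact (Real.lt_sqrt (hw 1).1.le).2 (by simpa using hg)
  · rintro ⟨hu, h0, h1⟩
    have hu' : 0 < z 0 ∧ z 0 < 1 := by simpa using hu
    have h1' : z 1 < √(1 - z 0 ^ 2) := by simpa using h1
    have hsq : z 1 ^ 2 < 1 - z 0 ^ 2 := (Real.lt_sqrt h0.le).1 h1'
    have hle : √(1 - z 0 ^ 2) ≤ 1 := (Real.sqrt_le_sqrt (by nlinarith)).trans_eq Real.sqrt_one
    refine ⟨fun j => ?_, by linarith⟩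
    fin_cases j
    · exact hu'
    · exact ⟨h0, by simpa using h1'.trans_le hle⟩

/-- The closed band `0 ≤ v ≤ √(1 − u²)` over `(0,1)` lies in the closed unit square. [folklore] -/
theorem band_unitIoo_subset_Icc :
    KZlog.band unitIoo (fun _ => (0:ℝ)) (fun u => √(1 - u 0 ^ 2)) ⊆ Icc 0 1 := by
  intro z hz
  rw [KZlog.mem_band] at hz
  obtain ⟨hu, h0, h1⟩ := hz
  rw [mem_unitIoo] at hu
  have hu' : 0 < z 0 ∧ z 0 < 1 := by simpa [Fin.init] using hu
  have hle : √(1 - Fin.init z 0 ^ 2) ≤ 1 :=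
    (Real.sqrt_le_sqrt (by simp [Fin.init]; nlinarith)).trans_eq Real.sqrt_one
  refine ⟨fun j => ?_, fun j => ?_⟩
  · fin_cases j
    · exact hu'.1.le
    · simpa using h0
  · fin_cases j
    · exact hu'.2.le
    · simpa using h1.trans hle

/-- **Moves (3) + (1a):** `[quarter disc, w] ≡ [(0,1), w·√(1 − u²)]` — Newton–Leibniz along `v`
with the primitive `w·v` over `(0,1)` (closed fibres `[0, √(1−u²)]`), then opening the fibres.
[KontsevichZagier2001 §1.2 rules (1), (3)] -/
theorem of_disc_sub_of_sqrtRep_mem_relations (w : ℚ) :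
    KZ.of (cellRep discPoly w) - KZ.of (sqrtRep w) ∈ KZ.relations := by
  have hBs := isSemialgebraic_unitIoo
  have ha : IsSemialgebraicFunOn ℚ unitIoo (fun _ => (0:ℝ)) := by
    simpa using isSemialgebraicFunOn_ratCast hBs 0
  have hb : IsSemialgebraicFunOn ℚ unitIoo (fun u => √(1 - u 0 ^ 2)) :=
    isSemialgebraicFunOn_sqrtOneSub
  have hband : IsSemialgebraic ℚ (KZlog.band unitIoo (fun _ => (0:ℝ)) (fun u => √(1 - u 0 ^ 2))) :=
    KZlog.isSemialgebraic_band ha hb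
  obtain ⟨rb, rd, hrbd, hrbi, hrdd, hrdi, hrel⟩ := KZ.exists_band_newtonLeibniz hBs
    (fun _ => (0:ℝ)) (fun u => √(1 - u 0 ^ 2)) ha hb (fun _ _ => Real.sqrt_nonneg _)
    (fun z => (w : ℝ) * z (Fin.last 1)) (fun _ => (w : ℝ))
    ((isSemialgebraicFunOn_aeval hband (C w * X (Fin.last 1))).congr fun z _ => by simp)
    (by simpa using isSemialgebraicFunOn_ratCast hband w)
    (fun x _ => by
      simp only [Fin.snoc_last]
      exact (continuous_const.mul continuous_id).continuousOn)
    (fun x _ t _ => by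
      simp only [Fin.snoc_last]
      simpa using (hasDerivAt_id t).const_mul (w : ℝ))
    (integrableOn_const (hs := ((measure_mono band_unitIoo_subset_Icc).trans_lt
      (isCompact_Icc.measure_lt_top)).ne))
    ((sqrtRep w).isSemialgebraicFunOn_integrand.congr fun x _ => by simp [sqrtRep])
    (by
      have : (fun x : Fin 1 → ℝ => (w : ℝ) * (Fin.snoc x ((fun u : Fin 1 → ℝ => √(1 - u 0 ^ 2)) x) :
          Fin 2 → ℝ) (Fin.last 1) - (w : ℝ) * (Fin.snoc x ((fun _ => (0:ℝ)) x) : Fin 2 → ℝ)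
          (Fin.last 1)) = fun u => (w : ℝ) * √(1 - u 0 ^ 2) := by
        funext x; simp
      rw [this]
      exact (sqrtRep w).integrableOn)
  obtain ⟨rb', hrb'd, hrb'i, hrel'⟩ := KZ.of_sub_of_restrict_openBand_mem_relations ha hb rb hrbd
  have hpin1 : KZ.of rb' - KZ.of (cellRep discPoly w) ∈ KZ.relations := by
    refine KZ.of_sub_of_mem_relations_of_eqOn ?_ fun z _ => ?_
    · rw [hrb'd]
      ext z
      simpa using mem_disc_iff_init z
    · rw [hrb'i, hrbi]
      simp
  have hpin2 : KZ.of rd - KZ.of (sqrtRep w) ∈ KZ.relations := by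
    refine KZ.of_sub_of_mem_relations_of_eqOn ?_ fun u _ => ?_
    · rw [hrdd]; rfl
    · rw [hrdi]; simp [sqrtRep]
  have : KZ.of (cellRep discPoly w) - KZ.of (sqrtRep w) =
      (KZ.of rb - KZ.of rd) - (KZ.of rb - KZ.of rb') - (KZ.of rb' - KZ.of (cellRep discPoly w)) +
        (KZ.of rd - KZ.of (sqrtRep w)) := by abel
  rw [this]
  exact add_mem (sub_mem (sub_mem hrel hrel') hpin1) hpin2

/-! #### Euler's substitution `x = (1 − t²)/(1 + t²)`: `[(0,1), w·√(1−x²)] ≡ [(0,1), 8wt²/(1+t²)³]` -/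

/-- `[(0,1), w · 8t²/(1+t²)³]` — a RATIONAL one-variable integrand on a rational cell: a generator
of the Baker sector. [KontsevichZagier2001 §1.1] -/
def ratRep (w : ℚ) : KZ.IntegralRep 1 where
  domain := unitIoo
  integrand t := (w : ℝ) * (8 * t 0 ^ 2 / (1 + t 0 ^ 2) ^ 3)
  isSemialgebraic_domain := isSemialgebraic_unitIoo
  isSemialgebraicFunOn_integrand :=
    (isSemialgebraicFunOn_aeval_div_aeval isSemialgebraic_unitIoo (C w * (8 * X 0 ^ 2))
      ((1 + X 0 ^ 2) ^ 3) fun t _ => by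
        have h : (0:ℝ) < (1 + t 0 ^ 2) ^ 3 := by positivity
        simpa using h.ne').congr fun t _ => by simp; ring
  integrableOn := by
    refine (ContinuousOn.integrableOn_compact isCompact_Icc ?_).mono_set unitIoo_subset_Icc
    have hc : Continuous fun t : Fin 1 → ℝ => (w : ℝ) * (8 * t 0 ^ 2 / (1 + t 0 ^ 2) ^ 3) := by
      refine continuous_const.mul (Continuous.div ?_ ?_ fun t => ?_)
      · exact continuous_const.mul ((continuous_apply 0).pow 2)
      · exact (continuous_const.add ((continuous_apply 0).pow 2)).pow 3
      · positivity
    exact hc.continuousOn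

/-- `[(0,1), w · 8t²/(1+t²)³]` has a rational integrand. [KontsevichZagier2001 §1.1] -/
theorem isRational_ratRep (w : ℚ) : (ratRep w).IsRational := by
  refine ⟨C w * (8 * X 0 ^ 2), (1 + X 0 ^ 2) ^ 3, fun t _ => ?_, fun t _ => ?_⟩
  · have h : (0:ℝ) < (1 + t 0 ^ 2) ^ 3 := by positivity
    simpa using h.ne'
  · simp [ratRep]
    ring

/-- Euler's substitution `Ψ(t) = (1 − t²)/(1 + t²)` on `ℝ¹`. -/
def eulerPhi : (Fin 1 → ℝ) → (Fin 1 → ℝ) := fun t _ => (1 - t 0 ^ 2) / (1 + t 0 ^ 2)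

/-- Components of Euler's substitution map. [definition] -/
@[simp] theorem eulerPhi_apply (t : Fin 1 → ℝ) (j : Fin 1) :
    eulerPhi t j = (1 - t 0 ^ 2) / (1 + t 0 ^ 2) := rfl

/-- Its derivative `Ψ'(t) = −4t/(1+t²)²` as a continuous linear map of `ℝ¹`. -/
def eulerMat (t : Fin 1 → ℝ) : Matrix (Fin 1) (Fin 1) ℝ := !![-(4 * t 0) / (1 + t 0 ^ 2) ^ 2]

/-- Auxiliary fact `eulerPhi'` for the cone specimen. [folklore] -/
def eulerPhi' (t : Fin 1 → ℝ) : (Fin 1 → ℝ) →L[ℝ] (Fin 1 → ℝ) :=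
  LinearMap.toContinuousLinearMap (Matrix.toLin' (eulerMat t))

/-- The derivative of Euler's substitution acts by `v ↦ −4t/(1+t²)² · v`. [calculus] -/
theorem eulerPhi'_apply (t v : Fin 1 → ℝ) (a : Fin 1) :
    eulerPhi' t v a = -(4 * t 0) / (1 + t 0 ^ 2) ^ 2 * v 0 := by
  change Matrix.toLin' (eulerMat t) v a = _
  rw [Matrix.toLin'_apply]
  fin_cases a
  simp [eulerMat, Matrix.mulVec, dotProduct]

/-- `det Ψ'(t) = −4t/(1+t²)²`. [calculus] -/
theorem eulerPhi'_det (t : Fin 1 → ℝ) : (eulerPhi' t).det = -(4 * t 0) / (1 + t 0 ^ 2) ^ 2 := by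
  change LinearMap.det (Matrix.toLin' (eulerMat t)) = _
  rw [LinearMap.det_toLin', eulerMat, Matrix.det_fin_one_of]

/-- Euler's substitution is differentiable with derivative `Ψ'`. [calculus] -/
theorem hasFDerivAt_eulerPhi (t : Fin 1 → ℝ) : HasFDerivAt eulerPhi (eulerPhi' t) t := by
  refine hasFDerivAt_pi'' fun a => ?_
  have h0 : HasFDerivAt (𝕜 := ℝ) (fun y : Fin 1 → ℝ => y 0)
      (ContinuousLinearMap.proj (R := ℝ) (φ := fun _ : Fin 1 => ℝ) 0) t :=
    hasFDerivAt_apply 0 t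
  have h : HasFDerivAt (fun y : Fin 1 → ℝ => (1 - y 0 ^ 2) / (1 + y 0 ^ 2))
      ((-(4 * t 0) / (1 + t 0 ^ 2) ^ 2) • ContinuousLinearMap.proj (R := ℝ) (φ := fun _ : Fin 1 => ℝ) 0) t :=
    HasDerivAt.comp_hasFDerivAt (h₂ := fun s : ℝ => (1 - s ^ 2) / (1 + s ^ 2)) t
      (by
        -- `d/ds (1 − s²)/(1 + s²) = −4s/(1+s²)²` (inlined; a landed twin lives in an unbuilt module)
        have h1 : HasDerivAt (fun s : ℝ => 1 - s ^ 2) (-(2 * t 0)) (t 0) := by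
          simpa using (hasDerivAt_pow 2 (t 0)).const_sub 1
        have h2 : HasDerivAt (fun s : ℝ => 1 + s ^ 2) (2 * t 0) (t 0) := by
          simpa using (hasDerivAt_pow 2 (t 0)).const_add 1
        have hne : (1 + t 0 ^ 2) ≠ 0 := by positivity
        exact (h1.div h2 hne).congr_deriv (by field_simp; ring)) h0
  exact h.congr_fderiv (ContinuousLinearMap.ext fun v => by
    simp [eulerPhi'_apply, smul_eq_mul])

/-- Euler's substitution is injective on `(0,1)`. [calculus] -/
theorem injOn_eulerPhi : InjOn eulerPhi unitIoo := by
  intro x hx y hy hxy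
  rw [mem_unitIoo] at hx hy
  have h := congrFun hxy 0
  simp only [eulerPhi_apply] at h
  have hx1 : (0:ℝ) < 1 + x 0 ^ 2 := by positivity
  have hy1 : (0:ℝ) < 1 + y 0 ^ 2 := by positivity
  rw [div_eq_div_iff hx1.ne' hy1.ne'] at h
  have hsq : x 0 ^ 2 = y 0 ^ 2 := by nlinarith
  have h0 : x 0 = y 0 := (pow_left_inj₀ hx.1.le hy.1.le two_ne_zero).1 hsq
  funext j
  fin_cases j
  exact h0

/-- Euler's substitution maps `(0,1)` onto `(0,1)`. [calculus] -/
theorem image_eulerPhi : eulerPhi '' unitIoo = unitIoo := by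
  ext x
  constructor
  · rintro ⟨t, ht, rfl⟩
    rw [mem_unitIoo] at ht ⊢
    simp only [eulerPhi_apply]
    have h1 : (0:ℝ) < 1 + t 0 ^ 2 := by positivity
    have h2 : 0 < t 0 ^ 2 := pow_pos ht.1 2
    have h3 : t 0 ^ 2 < 1 := by nlinarith [ht.1, ht.2]
    exact ⟨div_pos (by linarith) h1, (div_lt_one h1).2 (by linarith)⟩
  · intro hx
    rw [mem_unitIoo] at hx
    have hq : 0 < (1 - x 0) / (1 + x 0) := div_pos (by linarith) (by linarith)
    have hq1 : (1 - x 0) / (1 + x 0) < 1 := (div_lt_one (by linarith)).2 (by linarith)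
    refine ⟨fun _ => √((1 - x 0) / (1 + x 0)), ?_, ?_⟩
    · rw [mem_unitIoo]
      exact ⟨Real.sqrt_pos.2 hq, (Real.sqrt_lt' one_pos).2 (by simpa using hq1)⟩
    · funext j
      fin_cases j
      simp only [eulerPhi_apply, Fin.zero_eta]
      rw [Real.sq_sqrt hq.le]
      have : (1 + x 0) ≠ 0 := by linarith
      field_simp
      ring

/-- **Move (2), Euler's substitution:** `[(0,1), 8wt²/(1+t²)³] − [(0,1), w·√(1−x²)] ∈ relations`
along `x = Ψ(t) = (1−t²)/(1+t²)` (`√(1 − Ψ²) = 2t/(1+t²)`, `|Ψ'| = 4t/(1+t²)²`).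
[KontsevichZagier2001 §1.2 rule (2)] -/
theorem of_ratRep_sub_of_sqrtRep_mem_relations (w : ℚ) :
    KZ.of (ratRep w) - KZ.of (sqrtRep w) ∈ KZ.relations := by
  refine KZ.changeOfVariablesRel_subset_relations
    ⟨1, ratRep w, sqrtRep w, eulerPhi, eulerPhi', ?_,
      fun t _ => (hasFDerivAt_eulerPhi t).hasFDerivWithinAt, injOn_eulerPhi, image_eulerPhi.symm,
      fun t ht => ?_, rfl⟩
  · refine IsSemialgebraicMapOn.of_forall isSemialgebraic_unitIoo fun j => ?_
    exact (isSemialgebraicFunOn_aeval_div_aeval isSemialgebraic_unitIoo (1 - X 0 ^ 2) (1 + X 0 ^ 2)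
      fun t _ => by
        have h : (0:ℝ) < 1 + t 0 ^ 2 := by positivity
        simpa using h.ne').congr fun t _ => by simp
  · have ht0 : 0 < t 0 ∧ t 0 < 1 := ht 0
    have ht0' : 0 < t 0 := ht0.1
    have h1 : (0:ℝ) < 1 + t 0 ^ 2 := by positivity
    have hdet : (eulerPhi' t).det < 0 := by
      rw [eulerPhi'_det]
      exact div_neg_of_neg_of_pos (by linarith) (by positivity)
    show (w : ℝ) * (8 * t 0 ^ 2 / (1 + t 0 ^ 2) ^ 3) =
      (w : ℝ) * √(1 - (eulerPhi t 0) ^ 2) * |(eulerPhi' t).det|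
    rw [abs_of_neg hdet, eulerPhi'_det, eulerPhi_apply]
    have hsq : 1 - ((1 - t 0 ^ 2) / (1 + t 0 ^ 2)) ^ 2 = (2 * t 0 / (1 + t 0 ^ 2)) ^ 2 := by
      field_simp
      ring
    rw [hsq, Real.sqrt_sq (by positivity)]
    field_simp
    ring

/-! #### The cone lands in the Baker sector -/

/-- **`[cone, 1] ≡ [(0,1), 8t²/(3(1+t²)³)]`:** the cone 3-cell is equivalent under the three KZ
rules to a RATIONAL one-variable integral (`π/12 = ∫₀¹ 8t²/(3(1+t²)³) dt`).
[KontsevichZagier2001 §1.2; this node] -/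
theorem of_cone_sub_of_ratRep_mem_relations :
    KZ.of (cellRep conePoly 1) - KZ.of (ratRep (1 / 3)) ∈ KZ.relations := by
  have h1 := of_cone_sub_of_discThird_mem_relations
  have h2 := of_disc_sub_of_sqrtRep_mem_relations (1 / 3)
  have h3 := of_ratRep_sub_of_sqrtRep_mem_relations (1 / 3)
  have : KZ.of (cellRep conePoly 1) - KZ.of (ratRep (1 / 3)) =
      (KZ.of (cellRep conePoly 1) - KZ.of (cellRep discPoly (1 / 3))) +
        (KZ.of (cellRep discPoly (1 / 3)) - KZ.of (sqrtRep (1 / 3))) -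
        (KZ.of (ratRep (1 / 3)) - KZ.of (sqrtRep (1 / 3))) := by abel
  rw [this]
  exact sub_mem (add_mem h1 h2) h3

/-- **The cone is an instance of `QuadricBakerDescent`** (`d = 3`, `P = z² − x² − y²`, `q = 1`):
every representation with the cone's domain and integrand `1` is equivalent, modulo
`KZ.relations`, to an element of the Baker sector (the closure of the rational representations of
dimension `≤ 1`). Decided INSIDE the rules — no transcendence input.
[KontsevichZagier2001 §1.2; this node] -/
theorem cone_bakerDescent (ρ : KZ.IntegralRep 3)
    (hρ : ρ.domain = {x | (∀ j, 0 < x j ∧ x j < 1) ∧ 0 < MvPolynomial.aeval x conePoly} ∧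
      ∀ x ∈ ρ.domain, ρ.integrand x = ((1 : ℚ) : ℝ)) :
    ∃ y ∈ AddSubgroup.closure
        {y : KZ.FormalRep | ∃ (m : ℕ) (N : KZ.IntegralRep m), m ≤ 1 ∧ N.IsRational ∧ y = KZ.of N},
      KZ.of ρ - y ∈ KZ.relations := by
  refine ⟨KZ.of (ratRep (1 / 3)),
    AddSubgroup.subset_closure ⟨1, ratRep (1 / 3), le_rfl, isRational_ratRep _, rfl⟩, ?_⟩
  have hpin : KZ.of ρ - KZ.of (cellRep conePoly 1) ∈ KZ.relations :=
    KZ.of_sub_of_mem_relations_of_eqOn hρ.1.symm fun x hx => by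
      rw [hρ.2 x hx, cellRep_integrand]
  have : KZ.of ρ - KZ.of (ratRep (1 / 3)) =
      (KZ.of ρ - KZ.of (cellRep conePoly 1)) +
        (KZ.of (cellRep conePoly 1) - KZ.of (ratRep (1 / 3))) := by abel
  rw [this]
  exact add_mem hpin of_cone_sub_of_ratRep_mem_relations


end Summit.KontsevichZagierPeriods.RootDecompWalshStrata.ConeSpecimen

end
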